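import Literature.Analysis.SegalBargmann.SchrodingerCovariantUniqueness
import Literature.Analysis.Fourier.RadialSchwartzInterpolationGaussian
import HarnessLib

/-!
# The Schwartz ↔ `L²` bridge for the Schrödinger representation: Heisenberg operators on `𝓢(ℝ^σ)`, the dense embedding `𝓢 ↪ L²`, and transfer of covariance / rigidity to representations on Schwartz space (Folland 1989, §1.3, §4.2)

Topic `Analysis/SegalBargmann`; namespace `Literature.Analysis.SegalBargmann`.  The tree's rigidity theorems
(`FockHeisenbergSchur.rho_schur`, `SchrodingerCompactRigidity.IsRhoCovariant.apply`,
`SchrodingerCovariantUniqueness.IsPhaseCovariant.eq_relChar_smul`) are stated for UNITARY operators of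
`L²(ℝ^σ)`.  Representations that act on SCHWARTZ functions (the carrier of the archimedean component of an adelic
Schwartz–Bruhat space) reach them through this file:

* §1 Folland's multiplier `rhoMul p q = e^{2πi q·x + πi p·q}` has temperate growth
  (`hasTemperateGrowth_rhoMul`), so **`rhoS p q : 𝓢(ℝ^σ) →L[ℂ] 𝓢(ℝ^σ)`**, `(ρ(p,q)f)(x) = e^{2πi q·x + πi p·q} f(x+p)`
  (Folland (1.25)) is a continuous operator on Schwartz space (`rhoS_apply`);
* §2 **`toL2 : 𝓢(ℝ^σ) →L[ℂ] L²(ℝ^σ)`** (Mathlib's `SchwartzMap.toLpCLM`): injective (`toL2_injective`), dense range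
  (`denseRange_toL2`), and **`toL2_rhoS : toL2 (rhoS p q f) = rho p q (toL2 f)`** — the Schwartz-level operators ARE
  the tree's `L²` Schrödinger operators `rho p q` on the dense subspace;
* §3 `LiftsTo A U` (`toL2 ∘ A = U ∘ toL2`: the Schwartz operator `A` is the restriction of the `L²` operator `U`),
  uniqueness of the lift (`LiftsTo.unique`, by density), `liftsTo_rhoS`, composition;
* §4 **transfer**: Schwartz-level Heisenberg covariance `IsPhaseCovariantS γ ωS` of a family of operators on `𝓢`
  implies `IsPhaseCovariant γ ω` for any family of unitary lifts (`IsPhaseCovariantS.lift`, by density), hence the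
  rigidity conclusions pull back to `𝓢` by injectivity: two Schwartz-level covariant families with unitary,
  multiplicative lifts differ by the continuous unitary character `relChar` (`IsPhaseCovariantS.eq_relChar_smul`),
  and a `K`-covariant one acts by `vacCoeff • μ₀(ι k)` (`IsRhoCovariantS.toL2_apply`).

Everything is PROVED (tree: `Analysis.Fourier.hasTemperateGrowth_cexp_ofReal_mul_I`; Mathlib: `SchwartzMap.smulLeftCLM`, `compSubConstCLM`, `toLpCLM`, `denseRange_toLpCLM`,
`injective_toLp`; the tree files above); no cited statement is used as a hypothesis.

Use (pub-hodgecm model cell, W3-B → W2-∞(γ)): the owner of the archimedean Weil-representation term types it on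
`𝓢`; the fields "Heisenberg-covariant over `γ`" and "lifts to unitaries" are `IsPhaseCovariantS` + `LiftsTo`, and
this file turns them into the hypotheses of T9/T4.

## References

* [Folland1989] G. B. Folland, *Harmonic Analysis in Phase Space*, Princeton University Press, 1989, §1.3 (1.25)
  (the operators `ρ(p,q)` preserve `𝓢`), §4.2 (4.23) and the Schur remark following it.
  Locators: equation NUMBERS are the printed ones; page indices, where given elsewhere in this topic, refer to the
  held digitisation `book:folland1989-harmonic-analysis-phase-space`.
-/

noncomputable section

open MeasureTheory Complex SchwartzMap
open scoped InnerProductSpace ComplexConjugate Real FourierTransform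

namespace Literature.Analysis.SegalBargmann

variable {σ : Type*} [Fintype σ] [DecidableEq σ]

local notation "L2R" σ => Lp ℂ 2 (volume : Measure (σ → ℝ))
local notation "SR" σ => SchwartzMap (σ → ℝ) ℂ

/-! ## 1. The Heisenberg operators on Schwartz space -/

omit [DecidableEq σ] in
/-- The real phase `x ↦ 2π q·x + π p·q` has temperate growth (affine). [folklore] -/
theorem hasTemperateGrowth_rhoArg (p q : σ → ℝ) :
    (fun x : σ → ℝ => 2 * π * ∑ k, q k * x k + π * ∑ k, p k * q k).HasTemperateGrowth := by
  have h1 : (fun x : σ → ℝ => 2 * π * ∑ k, q k * x k).HasTemperateGrowth := by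
    have hL : (fun x : σ → ℝ => 2 * π * ∑ k, q k * x k) =
        ⇑((2 * π) • ∑ k, q k • ContinuousLinearMap.proj (R := ℝ) (φ := fun _ : σ => ℝ) k) := by
      funext x
      simp [smul_eq_mul]
    rw [hL]
    exact ContinuousLinearMap.hasTemperateGrowth _
  exact h1.add (Function.HasTemperateGrowth.const _)

omit [DecidableEq σ] in
/-- **Folland's multiplier has temperate growth**, so it acts on Schwartz space. [folklore] -/
theorem hasTemperateGrowth_rhoMul (p q : σ → ℝ) : (rhoMul p q).HasTemperateGrowth := by
  have h : rhoMul p q = (fun s : ℝ => cexp ((s : ℂ) * I)) ∘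
      fun x : σ → ℝ => 2 * π * ∑ k, q k * x k + π * ∑ k, p k * q k := rfl
  rw [h]
  exact Literature.Analysis.Fourier.hasTemperateGrowth_cexp_ofReal_mul_I.comp (hasTemperateGrowth_rhoArg p q)

/-- **The Heisenberg operator `ρ(p,q)` on Schwartz space** (Folland (1.25)):
`f ↦ e^{2πi q·x + πi p·q} f(x + p)`, a continuous linear operator of `𝓢(ℝ^σ)`. [cite: Folland1989, (1.25)] -/
def rhoS (p q : σ → ℝ) : (SR σ) →L[ℂ] SR σ :=
  (SchwartzMap.smulLeftCLM ℂ (rhoMul p q)).comp (SchwartzMap.compSubConstCLM ℂ (-p))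

omit [DecidableEq σ] in
/-- Pointwise formula: `(ρ(p,q) f)(x) = e^{2πi q·x + πi p·q} f(x + p)`. [cite: Folland1989, (1.25)] -/
@[simp] theorem rhoS_apply (p q : σ → ℝ) (f : SR σ) (x : σ → ℝ) :
    rhoS p q f x = rhoMul p q x * f (x + p) := by
  rw [rhoS, ContinuousLinearMap.comp_apply, SchwartzMap.smulLeftCLM_apply_apply (hasTemperateGrowth_rhoMul p q),
    SchwartzMap.compSubConstCLM_apply, smul_eq_mul, sub_neg_eq_add]

/-! ## 2. The dense embedding `𝓢(ℝ^σ) ↪ L²(ℝ^σ)` -/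

/-- **`toL2 : 𝓢(ℝ^σ) →L[ℂ] L²(ℝ^σ)`** (Mathlib's `SchwartzMap.toLpCLM` at `p = 2`). [folklore] -/
def toL2 : (SR σ) →L[ℂ] L2R σ := SchwartzMap.toLpCLM ℂ ℂ 2 (volume : Measure (σ → ℝ))

omit [DecidableEq σ] in
/-- Unfolding. [folklore] -/
theorem toL2_apply (f : SR σ) : toL2 f = f.toLp 2 (volume : Measure (σ → ℝ)) := rfl

omit [DecidableEq σ] in
/-- `toL2 f = f` almost everywhere. [folklore] -/
theorem coeFn_toL2 (f : SR σ) : ⇑(toL2 f) =ᵐ[volume] (f : (σ → ℝ) → ℂ) :=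
  SchwartzMap.coeFn_toLp f 2 _

omit [DecidableEq σ] in
/-- `toL2` is injective (a continuous function is determined by its a.e. class). [folklore] -/
theorem toL2_injective : Function.Injective (toL2 : (SR σ) → L2R σ) :=
  SchwartzMap.injective_toLp 2 _

omit [DecidableEq σ] in
/-- **Schwartz functions are dense in `L²`.** [folklore] -/
theorem denseRange_toL2 : DenseRange (toL2 : (SR σ) → L2R σ) :=
  SchwartzMap.denseRange_toLpCLM (E := σ → ℝ) (F := ℂ) (μ := volume) ENNReal.ofNat_ne_top

omit [DecidableEq σ] in
/-- Translation commutes with the embedding: `τ_p (toL2 f) = toL2 (f(· + p))`. [folklore] -/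
theorem translateL2_toL2 (p : σ → ℝ) (f : SR σ) :
    translateL2 p (toL2 f) = toL2 (SchwartzMap.compSubConstCLM ℂ (-p) f) := by
  apply Lp.ext
  have h1 := translateL2_coeFn p (toL2 f)
  have h2 : (fun x : σ → ℝ => (toL2 f : (σ → ℝ) → ℂ) (x + p)) =ᵐ[volume] fun x => (f : (σ → ℝ) → ℂ) (x + p) :=
    (measurePreserving_add_const p).quasiMeasurePreserving.ae_eq_comp (coeFn_toL2 f)
  have h3 := coeFn_toL2 (SchwartzMap.compSubConstCLM ℂ (-p) f)
  filter_upwards [h1, h2, h3] with x hx1 hx2 hx3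
  rw [hx1, hx2, hx3, SchwartzMap.compSubConstCLM_apply, sub_neg_eq_add]

omit [DecidableEq σ] in
/-- **The Schwartz-level Heisenberg operators are the `L²` ones on the dense subspace**:
`toL2 (rhoS p q f) = rho p q (toL2 f)`. [cite: Folland1989, (1.25)] -/
theorem toL2_rhoS (p q : σ → ℝ) (f : SR σ) : toL2 (rhoS p q f) = rho p q (toL2 f) := by
  apply Lp.ext
  have h1 := coeFn_toL2 (rhoS p q f)
  have h2 := rho_coeFn p q (toL2 f)
  have h3 : (fun x : σ → ℝ => (toL2 f : (σ → ℝ) → ℂ) (x + p)) =ᵐ[volume] fun x => (f : (σ → ℝ) → ℂ) (x + p) :=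
    (measurePreserving_add_const p).quasiMeasurePreserving.ae_eq_comp (coeFn_toL2 f)
  filter_upwards [h1, h2, h3] with x hx1 hx2 hx3
  rw [hx1, hx2, hx3, rhoS_apply]

/-! ## 3. Lifting Schwartz operators to `L²` operators -/

/-- **`A` on `𝓢` is the restriction of `U` on `L²`**: `toL2 (A f) = U (toL2 f)`. [folklore] -/
def LiftsTo (A : (SR σ) →ₗ[ℂ] SR σ) (U : (L2R σ) →L[ℂ] L2R σ) : Prop := ∀ f : SR σ, toL2 (A f) = U (toL2 f)

omit [DecidableEq σ] in
/-- `ρ(p,q)` on `𝓢` lifts to `ρ(p,q)` on `L²`. [folklore] -/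
theorem liftsTo_rhoS (p q : σ → ℝ) :
    LiftsTo ((rhoS p q : (SR σ) →L[ℂ] SR σ) : (SR σ) →ₗ[ℂ] SR σ)
      (((rho p q).toContinuousLinearEquiv : (L2R σ) ≃L[ℂ] L2R σ) : (L2R σ) →L[ℂ] L2R σ) :=
  fun f => toL2_rhoS p q f

omit [DecidableEq σ] in
/-- **The lift is unique** (Schwartz functions are dense and `U` is continuous). [folklore] -/
theorem LiftsTo.unique {A : (SR σ) →ₗ[ℂ] SR σ} {U U' : (L2R σ) →L[ℂ] L2R σ} (h : LiftsTo A U)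
    (h' : LiftsTo A U') : U = U' := by
  apply ContinuousLinearMap.ext
  intro g
  have hEq : Set.EqOn (⇑U) (⇑U') (Set.range (toL2 : (SR σ) → L2R σ)) := by
    rintro _ ⟨f, rfl⟩
    rw [← h f, ← h' f]
  exact congrFun (Continuous.ext_on denseRange_toL2 U.continuous U'.continuous hEq) g

omit [DecidableEq σ] in
/-- The identity lifts to the identity. [folklore] -/
theorem liftsTo_id : LiftsTo (LinearMap.id : (SR σ) →ₗ[ℂ] SR σ) (ContinuousLinearMap.id ℂ (L2R σ)) :=
  fun _ => rfl

omit [DecidableEq σ] in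
/-- Lifts compose. [folklore] -/
theorem LiftsTo.comp {A B : (SR σ) →ₗ[ℂ] SR σ} {U V : (L2R σ) →L[ℂ] L2R σ} (hA : LiftsTo A U)
    (hB : LiftsTo B V) : LiftsTo (A.comp B) (U.comp V) := fun f => by
  rw [LinearMap.comp_apply, hA, hB, ContinuousLinearMap.comp_apply]

omit [DecidableEq σ] in
/-- A lifted operator is determined on `𝓢` by its lift: `toL2`-injectivity. [folklore] -/
theorem LiftsTo.apply_eq_iff {A B : (SR σ) →ₗ[ℂ] SR σ} {U : (L2R σ) →L[ℂ] L2R σ} (hA : LiftsTo A U)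
    (hB : LiftsTo B U) (f : SR σ) : A f = B f :=
  toL2_injective (by rw [hA, hB])

/-! ## 4. Transfer of covariance and rigidity to Schwartz-level families -/

variable {H : Type*}

/-- The unitary lift of a family, as continuous linear maps. [folklore] -/
abbrev liftCLM (ω : H → ((L2R σ) ≃ₗᵢ[ℂ] L2R σ)) (h : H) : (L2R σ) →L[ℂ] L2R σ :=
  ((ω h).toContinuousLinearEquiv : (L2R σ) ≃L[ℂ] L2R σ)

omit [DecidableEq σ] in
/-- Unfolding `liftCLM`. [folklore] -/
@[simp] theorem liftCLM_apply (ω : H → ((L2R σ) ≃ₗᵢ[ℂ] L2R σ)) (h : H) (g : L2R σ) :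
    liftCLM ω h g = ω h g := rfl

/-- **Schwartz-level Heisenberg covariance** over a family of phase-space maps:
`ωS h ∘ ρ(p,q) = ρ(γ h (p,q)) ∘ ωS h` on `𝓢(ℝ^σ)`. [cite: Folland1989, §4.2, (4.23)] -/
def IsPhaseCovariantS (γ : H → PhaseMap σ) (ωS : H → ((SR σ) →ₗ[ℂ] SR σ)) : Prop :=
  ∀ (h : H) (p q : σ → ℝ) (f : SR σ),
    ωS h (rhoS p q f) = rhoS (γ h (p, q)).1 (γ h (p, q)).2 (ωS h f)

omit [DecidableEq σ] in
/-- **Covariance transfers to the unitary lifts** (by density of `𝓢` in `L²`). [folklore] -/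
theorem IsPhaseCovariantS.lift {γ : H → PhaseMap σ} {ωS : H → ((SR σ) →ₗ[ℂ] SR σ)}
    {ω : H → ((L2R σ) ≃ₗᵢ[ℂ] L2R σ)} (hS : IsPhaseCovariantS γ ωS) (hlift : ∀ h, LiftsTo (ωS h) (liftCLM ω h)) :
    IsPhaseCovariant γ ω := by
  intro h p q g
  set p' := (γ h (p, q)).1
  set q' := (γ h (p, q)).2
  -- the two continuous maps `g ↦ ω h (ρ(p,q) g)` and `g ↦ ρ(p',q') (ω h g)` agree on `toL2 (𝓢)`
  have hEq : Set.EqOn (fun g : L2R σ => ω h (rho p q g)) (fun g => rho p' q' (ω h g))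
      (Set.range (toL2 : (SR σ) → L2R σ)) := by
    rintro _ ⟨f, rfl⟩
    have h1 := hlift h (rhoS p q f)
    have h2 := hlift h f
    simp only [liftCLM_apply] at h1 h2
    show ω h (rho p q (toL2 f)) = rho p' q' (ω h (toL2 f))
    rw [← toL2_rhoS, ← h1, hS h p q f, toL2_rhoS, h2]
  have hc1 : Continuous fun g : L2R σ => ω h (rho p q g) := (ω h).continuous.comp (rho p q).continuous
  have hc2 : Continuous fun g : L2R σ => rho p' q' (ω h g) := (rho p' q').continuous.comp (ω h).continuous
  exact congrFun (Continuous.ext_on denseRange_toL2 hc1 hc2 hEq) g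

/-- **Rigidity on Schwartz space**: two Schwartz-level families, covariant over the SAME phase-space maps and
lifting to multiplicative unitary families, differ by the continuous unitary character `relChar` of T9:
`ωS′ h f = relChar h • ωS h f`. [cite: Folland1989, §4.2, (4.23) and the Schur remark following it] -/
theorem IsPhaseCovariantS.eq_relChar_smul [Group H] {γ : H → PhaseMap σ}
    {ωS ωS' : H → ((SR σ) →ₗ[ℂ] SR σ)} {ω ω' : H → ((L2R σ) ≃ₗᵢ[ℂ] L2R σ)}
    (hS : IsPhaseCovariantS γ ωS) (hS' : IsPhaseCovariantS γ ωS')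
    (hlift : ∀ h, LiftsTo (ωS h) (liftCLM ω h)) (hlift' : ∀ h, LiftsTo (ωS' h) (liftCLM ω' h))
    (hω1 : ∀ f : L2R σ, ω 1 f = f) (hω1' : ∀ f : L2R σ, ω' 1 f = f)
    (hωm : ∀ (h h' : H) (f : L2R σ), ω (h * h') f = ω h (ω h' f))
    (hωm' : ∀ (h h' : H) (f : L2R σ), ω' (h * h') f = ω' h (ω' h' f)) (h : H) (f : SR σ) :
    ωS' h f = (((relChar (hS.lift hlift) (hS'.lift hlift') hω1 hω1' hωm hωm' h : Circle) : ℂ)) • ωS h f := by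
  apply toL2_injective
  have h1 := hlift' h f
  have h2 := hlift h f
  simp only [liftCLM_apply] at h1 h2
  rw [h1, map_smul, h2]
  exact (hS.lift hlift).eq_relChar_smul (hS'.lift hlift') hω1 hω1' hωm hωm' h (toL2 f)

/-- **Schwartz-level covariance over a unitary family** `ι : H → U(σ)` (the compact case). [folklore] -/
def IsRhoCovariantS (ι : H → Matrix.unitaryGroup σ ℂ) (ωS : H → ((SR σ) →ₗ[ℂ] SR σ)) : Prop :=
  IsPhaseCovariantS (fun h => realify (ι h)) ωS

/-- Transfer to the lifts in the unitary case. [folklore] -/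
theorem IsRhoCovariantS.lift {ι : H → Matrix.unitaryGroup σ ℂ} {ωS : H → ((SR σ) →ₗ[ℂ] SR σ)}
    {ω : H → ((L2R σ) ≃ₗᵢ[ℂ] L2R σ)} (hS : IsRhoCovariantS ι ωS) (hlift : ∀ h, LiftsTo (ωS h) (liftCLM ω h)) :
    IsRhoCovariant ι ω :=
  (isRhoCovariant_iff_isPhaseCovariant ι ω).2 (IsPhaseCovariantS.lift hS hlift)

/-- **Compact rigidity on Schwartz space**: a Schwartz-level family covariant over `ι : H → U(σ)` with unitary
lifts acts, inside `L²`, by `vacCoeff ω h • μ₀(ι h)`: `toL2 (ωS h f) = vacCoeff ω h • schrodingerU (ι h) (toL2 f)`.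
[cite: Folland1989, Prop. (4.39)] -/
theorem IsRhoCovariantS.toL2_apply {ι : H → Matrix.unitaryGroup σ ℂ} {ωS : H → ((SR σ) →ₗ[ℂ] SR σ)}
    {ω : H → ((L2R σ) ≃ₗᵢ[ℂ] L2R σ)} (hS : IsRhoCovariantS ι ωS) (hlift : ∀ h, LiftsTo (ωS h) (liftCLM ω h))
    (h : H) (f : SR σ) :
    toL2 (ωS h f) = vacCoeff ω h • schrodingerU (ι h) (toL2 f) := by
  have h1 := hlift h f
  simp only [liftCLM_apply] at h1
  rw [h1]
  exact (hS.lift hlift).apply h (toL2 f)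

end Literature.Analysis.SegalBargmann
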